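import Summits.QuantumFields.YangMills.Theorems.UnitScaleTiltProp7CurrentSlavingFlat
import Literature.MathematicalPhysics.QuantumFieldTheory.Balaban1983to89.B10Eq68TorusRegularity
import HarnessLib

/-!
# Route `UnitScaleTilt`, crux K1 child «MinimiserStabilityRegPr» (stmt-QuantumFields-19200), registered stub `stub_prop7From14` (V3, skeleton v7
# cc37a1787726) — lane B, «the current is slaved to the curvature under the Euler–Lagrange port»: **THE SLICE-WISE AXIAL PRESENTATION** — for ANY
# units-valued `V` with plaquette variables within `f` of `1`, the gauge transformation `x ↦ V(Γ_{y(x),x})` (torus comb based at the point `y(x)` of a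
# fixed transverse corner line with the SAME axial coordinate as `x`) makes every TRANSVERSE bond of the blocks along that axis within
# `(d − 1)·L^k·f` of `1` — no drift along the axis, no global gauge condition; exactly the presentation hypothesis of
# `Prop7CurrentSlaving.abs_bondAvgIter_covDivT_le_local` ∕ `abs_current_le_of_multiplier_T3_local`

Cell `ym3-torus` ∕ fleet seat `ym-ust-19200-p3` (WIDTH-LEVER lane B of V3; HUMAN RULING D-0037, YM ladder rung R3).  `--supports stmt-QuantumFields-19200
--as helper`.

WHY.  The local slaving estimate needs `‖V(b) − 1‖ ≤ a` only for the transverse bonds `b = ⟨x − e_ν, ν⟩`, `ν ≠ μ`, at the sites `x` of the blocks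
`B^k(x₀ + s·e_μ)` along the axis `μ`.  Gauging each transverse slice `{x_μ = const}` by the comb axial gauge of [Balaban1985Averaging] p. 24 based at the
slice's corner point (`B10Eq27TorusAxialLog.axialT`; bound `norm_holT_contourT_sub_one_le` «|V₀,b − 1| < |b₋ − y|α₀») gives `a = (d − 1)·L^k·f`
uniformly along the axis: both end-points of a transverse bond lie in the same slice, so its gauged value is the holonomy of (27)'s contour inside the
slice, within `|b₋ − y|₁·f ≤ (d − 1)L^k·f` of `1`.  The axial bonds are not controlled (different bases at their two ends) — and not needed.

WHAT IS PROVED (sorry-free, no definition, standard axioms; every torus of `Setup`, `k` in the standing range, any normed algebra with `‖1‖ = 1`):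
* `two_mul_pow_le_sitesPerDir_zero` (`2L^k ≤ N₀`), `transverse_coord_eq` (the transverse coordinates of the tube sites), `mem_U1_axialT` (the comb transports
  are in `{‖u‖ ≤ 1, ‖u⁻¹‖ ≤ 1}`),
* **`norm_sliceAxial_transverse_sub_one_le`**: for `V` with values in `U1` and `‖V(∂p) − 1‖ ≤ f` at every plaquette, the slice-wise axial presentation
  `W = V^g`, `g(x) = V(Γ_{y(x),x})`, `y(x) = ` the corner line point with axial coordinate `x_μ`, satisfies `‖W(⟨x − e_ν, ν⟩) − 1‖ ≤ (d − 1)·L^k·f` for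
  every `ν ≠ μ` and every site `x = x_r + t·e_μ` of the tubes of the coarse bonds `⟨x₀ + s·e_μ, μ⟩` (all `s`, `t`),
* `norm_plaqFT_sliceAxial_sub_one`, `norm_covDivT_sliceAxial` (gauge invariance of the two members of (2), tree lemmas BY NAME).
HONEST SCOPE.  Lattice gauge bookkeeping; nothing of Bałaban's analysis; not a claim about the mass gap.

References: T. Bałaban, CMP **98** (1985) 17–51 [Balaban1985Averaging] (p.24–25, (8) p.19); CMP **102** (1985) 277–309 [Balaban1985Variational] ((2) p.278);
CMP **99** (1985) 75–102 [Balaban1985RegularSpaces] ((1.11) p.77).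
-/

set_option autoImplicit false

noncomputable section

open scoped BigOperators

namespace Summit.QuantumFields.YangMills.Theorems.Prop7CurrentSlaving

open Literature.MathematicalPhysics.QuantumFieldTheory.Balaban1983to89
open Finset LatticeFieldCalculus B1RG242Torus
open Summit.QuantumFields.YangMills.Theorems.Prop7FlatCoercivity (runSite_apply_self runSite_apply_of_ne sitesPerDir_zero_eq_pow_mul)
open B7Prop1Explicit (e l1 U1 mem_U1)
open B7Prop1Local (InBox PlaqIn)
open B7Prop2Explicit (hol_mem_of)
open B10Eq27TorusAxialLog (transl transl_apply rel rel_apply rel_transl_of_mem axialT holT holT_contourT_eq_gaugeActT gaugeActT gaugeActT_apply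
  norm_holT_contourT_sub_one_le hol_pull_zero pull_apply)
open B10Eq68TorusRegularity (plaqFT covDivT norm_plaqFT_gaugeActT_sub_one norm_covDivT_gaugeActT)

variable {P : Params} {k : ℕ}

/-! ## §1 Coordinates of the tube sites -/

/-- `2L^k ≤ N₀`: the finest torus has at least two `k`-blocks per direction (`N₀ = L^k·N_k`, `N_k = 2L^{m+K−k}`). [cite: Balaban1987RG1, (0.1) p.251] -/
theorem two_mul_pow_le_sitesPerDir_zero (hk : k ≤ P.m + P.K) : 2 * P.L ^ k ≤ P.sitesPerDir 0 := by
  rw [sitesPerDir_zero_eq_pow_mul hk]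
  have h1 : 1 ≤ P.L ^ (P.m + P.K - k) := Nat.one_le_pow _ _ P.L_pos
  show 2 * P.L ^ k ≤ P.L ^ k * (2 * P.L ^ (P.m + P.K - k))
  nlinarith [Nat.one_le_pow k P.L P.L_pos]

/-- The transverse coordinates of a tube site `x_r + t·e_μ`, `x_r ∈ B^k(x₀ + s·e_μ)`: for `κ ≠ μ` its label is `(x₀)_κ·L^k + r_κ`, whatever `s`, `t`.
[folklore] -/
theorem transverse_coord_eq (x₀ : Site P k) (μ : Fin P.d) (s t : ℕ) (r : Fin P.d → Fin (P.L ^ k))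
    {κ : Fin P.d} (hκ : κ ≠ μ) :
    (runSite (Site.fibreSite 0 k (runSite x₀ μ s) r) μ t) κ = (((x₀ κ).val * P.L ^ k + r κ : ℕ) : ZMod (P.sitesPerDir 0)) := by
  rw [runSite_apply_of_ne _ hκ]
  simp only [Site.fibreSite, runSite_apply_of_ne _ hκ]

/-! ## §2 The comb transports are norm-one units -/

section Units

variable {𝔸 : Type*} [NormedRing 𝔸] [NormOneClass 𝔸]

/-- The comb transport `V(Γ_{y,x})` of a `U1`-valued configuration is in `U1`. [cite: Balaban1985Averaging, p.24] -/
theorem mem_U1_axialT {j : ℕ} (V : GaugeField P j 𝔸ˣ) (hV : ∀ b, V b ∈ U1 𝔸) (y x : Site P j) : axialT V y x ∈ U1 𝔸 := by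
  unfold axialT
  rw [← hol_pull_zero]
  exact hol_mem_of (fun z κ => by rw [pull_apply]; exact hV _) 0 _

end Units

/-! ## §3 The slice-wise axial presentation: transverse bonds are near the identity, uniformly along the axis -/

section SliceAxial

variable {𝔸 : Type*} [NormedRing 𝔸] [NormOneClass 𝔸]

/-- **THE SLICE-WISE AXIAL PRESENTATION.**  Let `V` be `U1`-valued with `‖V(∂p) − 1‖ ≤ f` at every plaquette, `x₀` a coarse site, `μ` a direction,
`z₀` the corner site of `B^k(x₀)`, and `g(x) = V(Γ_{y(x),x})` with `y(x) = z₀` moved to the axial coordinate of `x`.  Then for every site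
`x = x_r + t·e_μ` of the tubes along the axis (`x_r ∈ B^k(x₀ + s·e_μ)`, any `s`, `t`) and every transverse direction `ν ≠ μ`:
`‖(V^g)(⟨x − e_ν, ν⟩) − 1‖ ≤ (d − 1)·L^k·f`. [cite: Balaban1985Averaging, p.24-25; Balaban1985UV3, (27)-(28) p.263] -/
theorem norm_sliceAxial_transverse_sub_one_le (hk : k ≤ P.m + P.K) (hmK : 1 ≤ P.m + P.K) (V : GaugeField P 0 𝔸ˣ) (hV : ∀ b, V b ∈ U1 𝔸)
    {f : ℝ} (hf : 0 ≤ f)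
    (hfV : ∀ (x : Site P 0) (κ κ' : Fin P.d), κ ≠ κ' → ‖plaqFT V κ κ' x - 1‖ ≤ f)
    (x₀ : Site P k) (μ : Fin P.d) (s t : ℕ) (r : Fin P.d → Fin (P.L ^ k)) {ν : Fin P.d} (hν : ν ≠ μ) :
    ‖((gaugeActT (fun x : Site P 0 => axialT V (Function.update (Site.fibreSite 0 k x₀ fun _ => ⟨0, pow_pos P.L_pos k⟩) μ (x μ)) x) V
        ⟨(runSite (Site.fibreSite 0 k (runSite x₀ μ s) r) μ t).unshift ν, ν⟩ : 𝔸ˣ) : 𝔸) - 1‖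
      ≤ ((P.d : ℝ) - 1) * (P.L : ℝ) ^ k * f := by
  classical
  set z₀ : Site P 0 := Site.fibreSite 0 k x₀ fun _ => ⟨0, pow_pos P.L_pos k⟩ with hz₀
  set x : Site P 0 := runSite (Site.fibreSite 0 k (runSite x₀ μ s) r) μ t with hx
  set x' : Site P 0 := x.unshift ν with hx'
  set y : Site P 0 := Function.update z₀ μ (x μ) with hy
  have hN2 : 2 * P.L ^ k ≤ P.sitesPerDir 0 := two_mul_pow_le_sitesPerDir_zero hk
  have hLk : 1 ≤ P.L ^ k := Nat.one_le_pow _ _ P.L_pos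
  -- both end-points of the bond have the same base
  have hx'μ : x' μ = x μ := by rw [hx']; simp only [Site.unshift, Function.update_of_ne hν.symm]
  have hshift : x'.shift ν = x := by rw [hx', B10StarCount.shift_unshift]
  have hg : gaugeActT (fun w : Site P 0 => axialT V (Function.update z₀ μ (w μ)) w) V ⟨x', ν⟩ = gaugeActT (axialT V y) V ⟨x', ν⟩ := by
    rw [gaugeActT_apply, gaugeActT_apply]
    simp only [PBond.tgt, hshift, hx'μ, hy]
  -- the relative position of `x′` with respect to `y`
  set z : B7Prop1Explicit.Site P.d := fun κ => if κ = μ then 0 else if κ = ν then ((r ν : ℕ) : ℤ) - 1 else ((r κ : ℕ) : ℤ) with hz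
  have hcoord : ∀ κ : Fin P.d, κ ≠ μ → x κ = (((x₀ κ).val * P.L ^ k + r κ : ℕ) : ZMod (P.sitesPerDir 0)) :=
    fun κ hκ => transverse_coord_eq x₀ μ s t r hκ
  have hz₀κ : ∀ κ : Fin P.d, z₀ κ = (((x₀ κ).val * P.L ^ k + 0 : ℕ) : ZMod (P.sitesPerDir 0)) := fun κ => rfl
  have hx't : x' = transl y z := by
    funext κ
    rw [transl_apply]
    by_cases hκμ : κ = μ
    · subst hκμ
      simp only [hz, if_true, Int.cast_zero, add_zero, hy, Function.update_self, hx'μ]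
    · have hyκ : y κ = z₀ κ := by rw [hy, Function.update_of_ne hκμ]
      rw [hyκ, hz₀κ]
      by_cases hκν : κ = ν
      · subst hκν
        simp only [hz, if_neg hκμ, if_true]
        rw [hx']
        simp only [Site.unshift, Function.update_self, hcoord κ hκμ]
        push_cast
        ring
      · simp only [hz, if_neg hκμ, if_neg hκν]
        rw [hx']
        simp only [Site.unshift, Function.update_of_ne hκν, hcoord κ hκμ]
        push_cast
        ring
  -- the window conditions
  have hzbound : ∀ κ, -1 ≤ z κ ∧ z κ ≤ ((P.L ^ k : ℕ) : ℤ) - 1 := by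
    intro κ
    simp only [hz]
    have hLk' : (1 : ℤ) ≤ ((P.L ^ k : ℕ) : ℤ) := by exact_mod_cast hLk
    split_ifs with h1 h2
    · constructor <;> linarith
    · have := (r ν).isLt; constructor <;> omega
    · have := (r κ).isLt; constructor <;> omega
  have hN : 2 * ((P.L ^ k : ℕ) : ℤ) ≤ (P.sitesPerDir 0 : ℤ) := by exact_mod_cast hN2
  have hN3 : (3 : ℤ) ≤ (P.sitesPerDir 0 : ℤ) := by
    have h6 : 6 ≤ P.sitesPerDir 0 := by
      show 6 ≤ 2 * P.L ^ (P.m + P.K - 0)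
      have hL3 : 3 ≤ P.L := by have := P.hL.2; have := P.hL.1; rcases this with ⟨j, hj⟩; omega
      have : P.L ≤ P.L ^ (P.m + P.K - 0) := by
        rw [Nat.sub_zero]
        calc P.L = P.L ^ 1 := (pow_one _).symm
          _ ≤ P.L ^ (P.m + P.K) := Nat.pow_le_pow_right P.L_pos hmK
      omega
    exact_mod_cast (show 3 ≤ P.sitesPerDir 0 by omega)
  have hzwin : ∀ κ, z κ * 2 ∈ Set.Ioc (-(P.sitesPerDir 0 : ℤ)) (P.sitesPerDir 0) := by
    intro κ
    obtain ⟨h1, h2⟩ := hzbound κ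
    have hLk' : (1 : ℤ) ≤ ((P.L ^ k : ℕ) : ℤ) := by exact_mod_cast hLk
    exact ⟨by linarith, by linarith⟩
  have hrel : rel y x' = z := by rw [hx't]; exact rel_transl_of_mem y z hzwin
  -- the box `[−N₀, N₀]^d` and the crude plaquette hypothesis there
  set lo : B7Prop1Explicit.Site P.d := fun _ => -(P.sitesPerDir 0 : ℤ) with hlo
  set hi : B7Prop1Explicit.Site P.d := fun _ => (P.sitesPerDir 0 : ℤ) with hhi
  have hlohi : ∀ i, lo i ≤ hi i := fun i => by simp only [hlo, hhi]; linarith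
  have h0 : InBox lo hi 0 := fun i => by simp only [hlo, hhi, Pi.zero_apply]; constructor <;> linarith
  have hzin : InBox lo hi z := fun i => by
    obtain ⟨h1, h2⟩ := hzbound i
    simp only [hlo, hhi]; constructor <;> linarith
  have hzein : InBox lo hi (z + e ν) := fun i => by
    obtain ⟨h1, h2⟩ := hzbound i
    simp only [hlo, hhi, Pi.add_apply, B7Prop1Explicit.e_apply]
    split_ifs <;> constructor <;> linarith
  have h13 : ∀ (w : B7Prop1Explicit.Site P.d) (κ κ' : Fin P.d), κ ≠ κ' → PlaqIn lo hi (w, κ, κ') →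
      ‖((holT V (transl y w) (B7Prop1Explicit.plaqWord κ κ') : 𝔸ˣ) : 𝔸) - 1‖ ≤ f :=
    fun w κ κ' hκ _ => hfV (transl y w) κ κ' hκ
  -- no wrap-around at the bond, and the comb bound
  have hc : (rel y x' ν + 1) * 2 ≤ (P.sitesPerDir 0 : ℤ) := by
    rw [hrel]
    simp only [hz, if_neg hν, if_true]
    have h1 : ((r ν : ℕ) : ℤ) < ((P.L ^ k : ℕ) : ℤ) := by exact_mod_cast (r ν).isLt
    linarith
  have hmain := norm_holT_contourT_sub_one_le hlohi V hV y h13 hf h0 ⟨x', ν⟩ (by rw [hrel]; exact hzin)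
    (by rw [hrel]; exact hzein)
  rw [holT_contourT_eq_gaugeActT V y ⟨x', ν⟩ hc] at hmain
  rw [hg]
  refine hmain.trans ?_
  -- `|x′ − y|₁ ≤ (d − 1)·L^k`
  rw [hrel]
  have hl1 : (l1 z : ℝ) ≤ ((P.d : ℝ) - 1) * (P.L : ℝ) ^ k := by
    have hterm : ∀ κ : Fin P.d, ((z κ).natAbs : ℝ) ≤ if κ = μ then 0 else (P.L : ℝ) ^ k := by
      intro κ
      obtain ⟨h1, h2⟩ := hzbound κ
      by_cases hκμ : κ = μ
      · simp only [hκμ, if_true, hz]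
        simp
      · rw [if_neg hκμ]
        have hz' : ((z κ).natAbs : ℤ) ≤ ((P.L ^ k : ℕ) : ℤ) := by
          rw [Int.natCast_natAbs]
          have hLk' : (1 : ℤ) ≤ ((P.L ^ k : ℕ) : ℤ) := by exact_mod_cast hLk
          exact abs_le.2 ⟨by linarith, by linarith⟩
        have hz'' : ((z κ).natAbs : ℝ) ≤ ((P.L ^ k : ℕ) : ℝ) := by exact_mod_cast hz'
        refine hz''.trans (le_of_eq ?_)
        push_cast; ring
    calc (l1 z : ℝ) = ∑ κ : Fin P.d, ((z κ).natAbs : ℝ) := by simp only [l1]; push_cast; rfl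
      _ ≤ ∑ κ : Fin P.d, (if κ = μ then 0 else (P.L : ℝ) ^ k) := Finset.sum_le_sum fun κ _ => hterm κ
      _ = ((P.d : ℝ) - 1) * (P.L : ℝ) ^ k := by
          rw [Finset.sum_ite, Finset.sum_const_zero, zero_add, Finset.sum_const, nsmul_eq_mul]
          have hcard : ((Finset.univ.filter fun κ : Fin P.d => ¬κ = μ).card : ℝ) = (P.d : ℝ) - 1 := by
            have : (Finset.univ.filter fun κ : Fin P.d => ¬κ = μ) = Finset.univ.erase μ := by
              ext κ; simp [Finset.mem_erase, and_comm]
            rw [this, Finset.card_erase_of_mem (Finset.mem_univ _), Finset.card_univ, Fintype.card_fin, Nat.cast_sub P.hd]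
            push_cast; ring
          rw [hcard]
  exact mul_le_mul_of_nonneg_right hl1 hf |>.trans (le_of_eq (by ring))

/-- The slice-wise axial gauge transformation has values in `U1`, so the plaquette member of (2) is unchanged.
[cite: Balaban1985RegularSpaces, p.77 (last paragraph)] -/
theorem norm_plaqFT_sliceAxial_sub_one (V : GaugeField P 0 𝔸ˣ) (hV : ∀ b, V b ∈ U1 𝔸) (x₀ : Site P k) (μ κ κ' : Fin P.d)
    (x : Site P 0) :
    ‖plaqFT (gaugeActT (fun x : Site P 0 => axialT V (Function.update (Site.fibreSite 0 k x₀ fun _ => ⟨0, pow_pos P.L_pos k⟩) μ (x μ)) x) V)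
        κ κ' x - 1‖ = ‖plaqFT V κ κ' x - 1‖ :=
  norm_plaqFT_gaugeActT_sub_one (fun x => mem_U1_axialT V hV _ x) V κ κ' x

variable [NormedAlgebra ℂ 𝔸]

/-- The slice-wise axial gauge transformation has values in `U1`, so the divergence member of (2) is unchanged in norm.
[cite: Balaban1985RegularSpaces, (1.11) p.77] -/
theorem norm_covDivT_sliceAxial (V : GaugeField P 0 𝔸ˣ) (hV : ∀ b, V b ∈ U1 𝔸) (x₀ : Site P k) (μ μ' : Fin P.d) (x : Site P 0) :
    ‖covDivT 1 (gaugeActT (fun x : Site P 0 => axialT V (Function.update (Site.fibreSite 0 k x₀ fun _ => ⟨0, pow_pos P.L_pos k⟩) μ (x μ)) x) V)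
        μ' x‖ = ‖covDivT 1 V μ' x‖ :=
  norm_covDivT_gaugeActT 1 (fun x => mem_U1_axialT V hV _ x) V μ' x

end SliceAxial

end Summit.QuantumFields.YangMills.Theorems.Prop7CurrentSlaving

end
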